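import Summits.NavierStokesRegularity.FunctionalMining.NoGo.BudgetedSieves
import Literature.Analysis.FluidPDE.FluidComputer.EnstrophyProduction
import Literature.Analysis.FluidPDE.FluidComputer.GalerkinExistence
import Literature.Analysis.FluidPDE.FluidComputer.TimeReversal
import HarnessLib

/-!
# Functional mining NO-GO, Part C(i): quadratic Fourier energies on Galerkin truncations — balance, amplitude degrees, the census row and its dynamic reduction, sub-cubic budgets

Search for candidate a priori estimates; no regularity claim. Second of three modules filed
verbatim from the no-go seat's `NoGo.lean` (see `FunctionalMining/NoGo/BudgetedSieves.lean` for the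
full module documentation of Parts A–C); declarations unchanged.
-/

noncomputable section

open Filter
open scoped Topology

namespace Summit.NavierStokesRegularity.FunctionalMining

/-! ## Part C — the Galerkin instance -/

namespace Galerkin

open Literature.Analysis.FluidPDE.FluidComputer
open Literature.Analysis.FluidPDE.FluidComputer.ShellTransfer
open Literature.Analysis.FluidPDE.FluidComputer.ShellTransfer.TaylorGreenHat (scale scale_coeff)
open Literature.Analysis.FluidPDE.FluidComputer.ShellTransfer.ThreeWaves (tw B)
open Complex ComplexConjugate Finset
open scoped BigOperators

/-! ### Quadratic Fourier energies and their exact balance -/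

/-- The quadratic Fourier energy with weight `w`: `F_w = Σ_{k∈S} w(k)·½|û(k)|²` (enstrophy:
`w k = |k|²`; `Ḣ^s` energy: `w k = |k|^{2s}`; Littlewood–Paley energies: `w` a shell indicator).
[folklore] -/
def weightedEnergy (w : (Fin 3 → ℤ) → ℝ) (U : FourierVelocity) (S : Finset (Fin 3 → ℤ)) : ℝ :=
  ∑ k ∈ S, w k * modalEnergy U k

/-- Its viscous loss density `D_w = Σ_{k∈S} w(k)|k|²·½|û(k)|²` (so the loss rate is `2ν D_w`).
[folklore] -/
def weightedDissipation (w : (Fin 3 → ℤ) → ℝ) (U : FourierVelocity) (S : Finset (Fin 3 → ℤ)) : ℝ :=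
  ∑ k ∈ S, w k * knormSq k * modalEnergy U k

/-- Its truncated Euler production `T_w = Σ_{k∈S} w(k) T(k)`, `T(k) = Σ_{p∈S} modeTransfer û k p`.
[folklore] -/
def weightedTransfer (w : (Fin 3 → ℤ) → ℝ) (U : FourierVelocity) (S : Finset (Fin 3 → ℤ)) : ℝ :=
  ∑ k ∈ S, w k * energyRate U S k

/-- **Balance of a quadratic Fourier energy along the unforced Galerkin system**:
`dF_w/dt = −2ν D_w + T_w`. [folklore] -/
theorem hasDerivAt_weightedEnergy_galerkin (w : (Fin 3 → ℤ) → ℝ) {U : ℝ → FourierVelocity}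
    {S : Finset (Fin 3 → ℤ)} {ν : ℝ} {c : ℝ → (Fin 3 → ℤ) → ℂ}
    (hU : IsGalerkinSolution U S ν c fun _ _ _ => 0) (t : ℝ) :
    HasDerivAt (fun s => weightedEnergy w (U s) S)
      (-(2 * ν) * weightedDissipation w (U t) S + weightedTransfer w (U t) S) t := by
  have hs := HasDerivAt.sum (u := S) fun k hk =>
    (hasDerivAt_modalEnergy_galerkin hU t hk).const_mul (w k)
  have e : (fun s => weightedEnergy w (U s) S) = ∑ k ∈ S, fun s => w k * modalEnergy (U s) k := by
    funext s
    simp only [weightedEnergy, Finset.sum_apply]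
  rw [e]
  refine hs.congr_deriv ?_
  unfold weightedDissipation weightedTransfer
  rw [Finset.mul_sum, ← Finset.sum_add_distrib]
  refine Finset.sum_congr rfl fun k _ => ?_
  simp only [cdot, mul_zero, Finset.sum_const_zero, Complex.zero_re, add_zero]
  ring

/-! ### Amplitude degrees -/

/-- `k · (r û) = r (k · û)`. [folklore] -/
theorem kdot_scale (r : ℝ) (U : FourierVelocity) (k q : Fin 3 → ℤ) :
    kdot k ((scale r U).coeff q) = (r : ℂ) * kdot k (U.coeff q) := by
  unfold kdot
  rw [Finset.mul_sum]
  refine Finset.sum_congr rfl fun i _ => ?_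
  rw [scale_coeff]
  ring

/-- `conj(r û(k)) · (r û(p)) = r² (conj û(k) · û(p))`. [folklore] -/
theorem cdot_conj_scale (r : ℝ) (U : FourierVelocity) (k p : Fin 3 → ℤ) :
    cdot (fun i => conj ((scale r U).coeff k i)) ((scale r U).coeff p) =
      (r : ℂ) ^ 2 * cdot (fun i => conj (U.coeff k i)) (U.coeff p) := by
  unfold cdot
  rw [Finset.mul_sum]
  refine Finset.sum_congr rfl fun i _ => ?_
  simp only [scale_coeff, map_mul, Complex.conj_ofReal]
  ring

/-- **The mode-to-mode transfer is cubic**: `S(rû) = r³ S(û)`. [folklore] -/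
theorem modeTransfer_scale (r : ℝ) (U : FourierVelocity) (k p : Fin 3 → ℤ) :
    modeTransfer (scale r U) k p = r ^ 3 * modeTransfer U k p := by
  unfold modeTransfer
  rw [kdot_scale, cdot_conj_scale]
  have e : (r : ℂ) * kdot k (U.coeff (k - p)) * ((r : ℂ) ^ 2 * cdot (fun i => conj (U.coeff k i)) (U.coeff p)) =
      ((r ^ 3 : ℝ) : ℂ) * (kdot k (U.coeff (k - p)) * cdot (fun i => conj (U.coeff k i)) (U.coeff p)) := by
    push_cast
    ring
  rw [e, Complex.im_ofReal_mul]

/-- `T(k)` is cubic in the amplitude. [folklore] -/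
theorem energyRate_scale (r : ℝ) (U : FourierVelocity) (S : Finset (Fin 3 → ℤ)) (k : Fin 3 → ℤ) :
    energyRate (scale r U) S k = r ^ 3 * energyRate U S k := by
  unfold energyRate
  rw [Finset.mul_sum]
  exact Finset.sum_congr rfl fun p _ => modeTransfer_scale r U k p

/-- `E(k)` is quadratic in the amplitude. [folklore] -/
theorem modalEnergy_scale (r : ℝ) (U : FourierVelocity) (k : Fin 3 → ℤ) :
    modalEnergy (scale r U) k = r ^ 2 * modalEnergy U k := by
  simp only [modalEnergy, scale_coeff, Complex.normSq_mul, Complex.normSq_ofReal, ← Finset.mul_sum]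
  ring

/-- `F_w` is quadratic in the amplitude. [folklore] -/
theorem weightedEnergy_scale (w : (Fin 3 → ℤ) → ℝ) (r : ℝ) (U : FourierVelocity)
    (S : Finset (Fin 3 → ℤ)) : weightedEnergy w (scale r U) S = r ^ 2 * weightedEnergy w U S := by
  unfold weightedEnergy
  rw [Finset.mul_sum]
  refine Finset.sum_congr rfl fun k _ => ?_
  rw [modalEnergy_scale]
  ring

/-- `D_w` is quadratic in the amplitude. [folklore] -/
theorem weightedDissipation_scale (w : (Fin 3 → ℤ) → ℝ) (r : ℝ) (U : FourierVelocity)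
    (S : Finset (Fin 3 → ℤ)) :
    weightedDissipation w (scale r U) S = r ^ 2 * weightedDissipation w U S := by
  unfold weightedDissipation
  rw [Finset.mul_sum]
  refine Finset.sum_congr rfl fun k _ => ?_
  rw [modalEnergy_scale]
  ring

/-- `T_w` is cubic in the amplitude. [folklore] -/
theorem weightedTransfer_scale (w : (Fin 3 → ℤ) → ℝ) (r : ℝ) (U : FourierVelocity)
    (S : Finset (Fin 3 → ℤ)) :
    weightedTransfer w (scale r U) S = r ^ 3 * weightedTransfer w U S := by
  unfold weightedTransfer
  rw [Finset.mul_sum]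
  refine Finset.sum_congr rfl fun k _ => ?_
  rw [energyRate_scale]
  ring

/-- Scaling preserves the support. [folklore] -/
theorem scale_coeff_eq_zero {U : FourierVelocity} {p : Fin 3 → ℤ} (hp : U.coeff p = 0) (r : ℝ) :
    (scale r U).coeff p = 0 := by
  funext j
  simp [scale_coeff, hp]

/-! ### The census row and the dynamic reduction -/

/-- **A census row for the Galerkin system.** `F` obeys the differential budget `dF/dt ≤ Θ` along
every unforced Galerkin solution on the mode set `S` with viscosity `ν` (any pressure multiplier):
at every time `t` at which `s ↦ F (U s)` is differentiable, its derivative is `≤ Θ (U t)`. [folklore] -/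
def HoldsAlongGalerkin (S : Finset (Fin 3 → ℤ)) (ν : ℝ) (F Θ : FourierVelocity → ℝ) : Prop :=
  ∀ (U : ℝ → FourierVelocity) (c : ℝ → (Fin 3 → ℤ) → ℂ),
    IsGalerkinSolution U S ν c (fun _ _ _ => 0) → IsSupportedOn U S →
      ∀ t r : ℝ, HasDerivAt (fun s => F (U s)) r t → r ≤ Θ (U t)

/-- A budget may be weakened pointwise. [folklore] -/
theorem HoldsAlongGalerkin.mono {S : Finset (Fin 3 → ℤ)} {ν : ℝ} {F Θ Θ' : FourierVelocity → ℝ}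
    (h : HoldsAlongGalerkin S ν F Θ) (hΘ : ∀ V, Θ V ≤ Θ' V) : HoldsAlongGalerkin S ν F Θ' :=
  fun U c hU hs t r hr => (h U c hU hs t r hr).trans (hΘ _)

/-- **The dynamic reduction.** If `F` has an exact rate `R` along Galerkin solutions
(`d/dt F(U t) = R (U t)`), then a row `dF/dt ≤ Θ` that holds along every unforced Galerkin
solution on a symmetric mode set `S` (`ν ≥ 0`) holds as the pointwise inequality `R V ≤ Θ V` at
EVERY datum `V` supported in `S` — because the Galerkin system is globally solvable through `V`
(`GalerkinODE.exists_galerkinSolution`). [folklore] -/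
theorem rate_le_of_holdsAlongGalerkin {S : Finset (Fin 3 → ℤ)} (hS : ∀ k ∈ S, -k ∈ S) {ν : ℝ}
    (hν : 0 ≤ ν) {F Θ R : FourierVelocity → ℝ}
    (hrate : ∀ (U : ℝ → FourierVelocity) (c : ℝ → (Fin 3 → ℤ) → ℂ),
      IsGalerkinSolution U S ν c (fun _ _ _ => 0) → IsSupportedOn U S →
        ∀ t, HasDerivAt (fun s => F (U s)) (R (U t)) t)
    (h : HoldsAlongGalerkin S ν F Θ) (V : FourierVelocity) (hV : ∀ p ∉ S, V.coeff p = 0) :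
    R V ≤ Θ V := by
  obtain ⟨U, c, hU, hsupp, h0⟩ := GalerkinODE.exists_galerkinSolution S hS hν V hV
  have := h U c hU hsupp 0 (R (U 0)) (hrate U c hU hsupp 0)
  rwa [h0] at this

/-- **Trajectories add nothing (Galerkin).** For a functional with an exact rate `R` along Galerkin
solutions, the census row "`dF/dt ≤ Θ` along EVERY unforced Galerkin solution on a symmetric `S`,
`ν ≥ 0`" is EQUIVALENT to the static inequality `R V ≤ Θ V` at every datum supported in `S`
(global solvability one way, uniqueness of derivatives the other). [folklore] -/
theorem holdsAlongGalerkin_iff_rate_le {S : Finset (Fin 3 → ℤ)} (hS : ∀ k ∈ S, -k ∈ S) {ν : ℝ}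
    (hν : 0 ≤ ν) {F Θ R : FourierVelocity → ℝ}
    (hrate : ∀ (U : ℝ → FourierVelocity) (c : ℝ → (Fin 3 → ℤ) → ℂ),
      IsGalerkinSolution U S ν c (fun _ _ _ => 0) → IsSupportedOn U S →
        ∀ t, HasDerivAt (fun s => F (U s)) (R (U t)) t) :
    HoldsAlongGalerkin S ν F Θ ↔ ∀ V : FourierVelocity, (∀ p ∉ S, V.coeff p = 0) → R V ≤ Θ V := by
  refine ⟨fun h V hV => rate_le_of_holdsAlongGalerkin hS hν hrate h V hV, fun h U c hU hsupp t r hr => ?_⟩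
  rw [hr.unique (hrate U c hU hsupp t)]
  exact h (U t) (hsupp t)

/-! ### Sub-cubic budgets -/

/-- **Sub-cubic budgets.** `Θ` grows sub-cubically along the amplitude ray of every datum supported
in `S`: for some `q < 3`, every such `V` has a constant `C` with `Θ(A·V) ≤ C A^q` for all `A ≥ 1`.
Contains (`subcubicOn_of_homogeneous`, `SubcubicOn.add`) every affine/monomial Grönwall budget of
amplitude degree `< 3` in quadratic energies: `α + βF_w`, `Z_S^a K_S^b F_w^c` with
`2(a + b + c) < 3`, the scale-invariant `(Z_S/K_S)^θ F_w`, … [folklore] -/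
def SubcubicOn (S : Finset (Fin 3 → ℤ)) (Θ : FourierVelocity → ℝ) : Prop :=
  ∃ q : ℝ, q < 3 ∧ ∀ V : FourierVelocity, (∀ p ∉ S, V.coeff p = 0) →
    ∃ C : ℝ, ∀ A : ℝ, 1 ≤ A → Θ (scale A V) ≤ C * A ^ q

/-- The zero budget (plain monotonicity) is sub-cubic. [folklore] -/
theorem subcubicOn_zero (S : Finset (Fin 3 → ℤ)) : SubcubicOn S fun _ => 0 :=
  ⟨0, by norm_num, fun V _ => ⟨0, fun A _ => by simp⟩⟩

/-- A budget homogeneous of degree `q < 3` along amplitude rays (`Θ(A·V) = A^q Θ(V)`, `A ≥ 1`) is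
sub-cubic. [folklore] -/
theorem subcubicOn_of_homogeneous {S : Finset (Fin 3 → ℤ)} {Θ : FourierVelocity → ℝ} {q : ℝ}
    (hq : q < 3) (h : ∀ V (A : ℝ), 1 ≤ A → Θ (scale A V) = A ^ q * Θ V) : SubcubicOn S Θ :=
  ⟨q, hq, fun V _ => ⟨|Θ V|, fun A hA => by
    rw [h V A hA, mul_comm]
    exact mul_le_mul_of_nonneg_right (le_abs_self _) (Real.rpow_nonneg (by linarith) q)⟩⟩

/-- Sub-cubic budgets are closed under addition. [folklore] -/
theorem SubcubicOn.add {S : Finset (Fin 3 → ℤ)} {Θ₁ Θ₂ : FourierVelocity → ℝ}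
    (h₁ : SubcubicOn S Θ₁) (h₂ : SubcubicOn S Θ₂) : SubcubicOn S fun V => Θ₁ V + Θ₂ V := by
  obtain ⟨q₁, hq₁, h₁⟩ := h₁
  obtain ⟨q₂, hq₂, h₂⟩ := h₂
  refine ⟨max q₁ q₂, max_lt hq₁ hq₂, fun V hV => ?_⟩
  obtain ⟨C₁, hC₁⟩ := h₁ V hV
  obtain ⟨C₂, hC₂⟩ := h₂ V hV
  refine ⟨|C₁| + |C₂|, fun A hA => ?_⟩
  have hp1 : A ^ q₁ ≤ A ^ max q₁ q₂ := Real.rpow_le_rpow_of_exponent_le hA (le_max_left _ _)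
  have hp2 : A ^ q₂ ≤ A ^ max q₁ q₂ := Real.rpow_le_rpow_of_exponent_le hA (le_max_right _ _)
  have hq1p : 0 ≤ A ^ q₁ := Real.rpow_nonneg (by linarith) _
  have hq2p : 0 ≤ A ^ q₂ := Real.rpow_nonneg (by linarith) _
  have e1 : C₁ * A ^ q₁ ≤ |C₁| * A ^ max q₁ q₂ :=
    (mul_le_mul_of_nonneg_right (le_abs_self _) hq1p).trans
      (mul_le_mul_of_nonneg_left hp1 (abs_nonneg _))
  have e2 : C₂ * A ^ q₂ ≤ |C₂| * A ^ max q₁ q₂ :=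
    (mul_le_mul_of_nonneg_right (le_abs_self _) hq2p).trans
      (mul_le_mul_of_nonneg_left hp2 (abs_nonneg _))
  have := add_le_add (hC₁ A hA) (hC₂ A hA)
  linarith

/-- A non-negative multiple of a sub-cubic budget is sub-cubic (budgets `C·G`, `C ≥ 0`). [folklore] -/
theorem SubcubicOn.const_mul {S : Finset (Fin 3 → ℤ)} {Θ : FourierVelocity → ℝ}
    (h : SubcubicOn S Θ) {K : ℝ} (hK : 0 ≤ K) : SubcubicOn S fun V => K * Θ V := by
  obtain ⟨q, hq, h⟩ := h
  refine ⟨q, hq, fun V hV => ?_⟩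
  obtain ⟨C, hC⟩ := h V hV
  exact ⟨K * C, fun A hA => by
    rw [mul_assoc]
    exact mul_le_mul_of_nonneg_left (hC A hA) hK⟩

/-- The truncated enstrophy is the quadratic energy with weight `|k|²`. [folklore] -/
theorem truncEnstrophy_eq_weightedEnergy (U : FourierVelocity) (S : Finset (Fin 3 → ℤ)) :
    truncEnstrophy U S = weightedEnergy (fun k => knormSq k) U S := rfl

/-- The truncated energy is the quadratic energy with weight `1`. [folklore] -/
theorem truncEnergy_eq_weightedEnergy (U : FourierVelocity) (S : Finset (Fin 3 → ℤ)) :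
    truncEnergy U S = weightedEnergy (fun _ => 1) U S := by
  unfold truncEnergy weightedEnergy
  simp

/-- `Z_S(A·V) = A² Z_S(V)`. [folklore] -/
theorem truncEnstrophy_scale (r : ℝ) (U : FourierVelocity) (S : Finset (Fin 3 → ℤ)) :
    truncEnstrophy (scale r U) S = r ^ 2 * truncEnstrophy U S := by
  rw [truncEnstrophy_eq_weightedEnergy, truncEnstrophy_eq_weightedEnergy, weightedEnergy_scale]

/-- `K_S(A·V) = A² K_S(V)`. [folklore] -/
theorem truncEnergy_scale (r : ℝ) (U : FourierVelocity) (S : Finset (Fin 3 → ℤ)) :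
    truncEnergy (scale r U) S = r ^ 2 * truncEnergy U S := by
  rw [truncEnergy_eq_weightedEnergy, truncEnergy_eq_weightedEnergy, weightedEnergy_scale]

/-- **Monomial budgets `K · Z_S^a · K_S^b · F_w^c` with `2(a+b+c) < 3`, `K ≥ 0` (and `F_w ≥ 0`), are
sub-cubic** (this covers the linear Grönwall budget `K·F_w`, `K·Z_S^{1/4}·F_w`, `K·(K_S Z_S)^{1/4}`,
and negative powers such as the scale-free `K·(Z_S/K_S)·F_w^{1/4}`). [folklore] -/
theorem subcubicOn_monomial (S : Finset (Fin 3 → ℤ)) (w : (Fin 3 → ℤ) → ℝ) {K a b c : ℝ}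
    (hK : 0 ≤ K) (habc : 2 * (a + b + c) < 3) (hw : ∀ V, 0 ≤ weightedEnergy w V S) :
    SubcubicOn S fun V =>
      K * (truncEnstrophy V S ^ a * truncEnergy V S ^ b * weightedEnergy w V S ^ c) := by
  refine SubcubicOn.const_mul (subcubicOn_of_homogeneous (q := 2 * (a + b + c)) habc fun V A hA => ?_) hK
  show truncEnstrophy (scale A V) S ^ a * truncEnergy (scale A V) S ^ b * weightedEnergy w (scale A V) S ^ c =
    A ^ (2 * (a + b + c)) * (truncEnstrophy V S ^ a * truncEnergy V S ^ b * weightedEnergy w V S ^ c)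
  have hA : 0 ≤ A := by linarith
  have hA2 : 0 ≤ A ^ 2 := pow_nonneg hA 2
  have hE : 0 ≤ truncEnergy V S := Finset.sum_nonneg fun k _ => modalEnergy_nonneg V k
  rw [truncEnstrophy_scale, truncEnergy_scale, weightedEnergy_scale,
    Real.mul_rpow hA2 (truncEnstrophy_nonneg V S), Real.mul_rpow hA2 hE, Real.mul_rpow hA2 (hw V)]
  have e : ∀ t : ℝ, (A ^ 2) ^ t = A ^ (2 * t) := fun t => by
    rw [← Real.rpow_two, ← Real.rpow_mul hA]
  rw [e, e, e]
  have esum : A ^ (2 * (a + b + c)) = A ^ (2 * a) * A ^ (2 * b) * A ^ (2 * c) := by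
    have hA0 : 0 < A := by linarith
    rw [show 2 * (a + b + c) = 2 * a + 2 * b + 2 * c by ring, Real.rpow_add hA0, Real.rpow_add hA0]
  rw [esum]
  ring

end Galerkin

end Summit.NavierStokesRegularity.FunctionalMining

end
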